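import Summits.Ventures.CertifiedManyBodySolver.Observables.TIGrandCanonicalChordFloor
import Literature.MathematicalPhysics.QuantumLattice.PairSourcedTorusTrialStateLimit
import HarnessLib

/-!
# The «tiled-trial-state TI bridge» in the GRAND-CANONICAL class: ONE periodic torus trial family discharges
# the sourced cap of the `μ`-pencil chord floor (the W5 single-state reading)

Cell hubbard-cq (rung CQ, CQ-TABLE §B1-U; lead rulings 2026-08-26T20:18:50Z / 20:28:40Z: «GC fallback = ONE node
= the tangent row of #473 + obsth-3's consumer `TIGrandCanonicalChordFloor` + p2's bridge reading var-10's SINGLE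
μ* state»). Companion of `TISourcedTiledTrialBridge.lean` (canonical TI-density class: TWO bracketing families and
a mixture). In the grand-canonical class of `TIGrandCanonicalChordFloor.lean` — translation-invariant states of any
density in `(0,2)`, sourced energy on the `μ`-pencil `E^{μ}_h(ω) = ω.meanEnergy (hubbardTTPrimeSourcedInteraction 1
t′ U μ dWaveFormFactor h) 1` — NO bracketing pair and NO mixture is needed: a single periodic family of unit torus
trial vectors with exact rows `Re⟨ψ, Nψ⟩ = n·L²`, `Re⟨ψ, A_L ψ⟩ = e·L²` (the tiled product of ONE parity-definite
cluster / box vector; rows either on the `μ`-pencil torus operator `dWaveSourceTorusTT' L t′ U μ h` or on the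
`μ = 0` pencil, converted by `E^{μ}_h(σ) = E^{0}_h(σ) − μ·n`, `meanEnergy_hubbardTTPrimeSourced_mu_eq`) produces, by
`exists_isTranslationInvariant_density_eq_meanEnergy_sourced_eq_of_periodic_trialStates`
(`Literature/…/PairSourcedTorusTrialStateLimit.lean`), a translation-invariant `σ` of density `n` with
`E^{μ}_h(σ) = e` (resp. `e₀ − μn`) — the hypothesis `hcap` of `re_expect_localPairAt_ge_of_gcEpsMinimiser`.

* §1 `exists_gcClass_sourced_le_of_periodic_trialStates` (+ `μ = 0`-row and `t′ = 0` forms) — the GC `hcap`;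
  `re_expect_localPairAt_ge_of_gcEpsMinimiser_of_periodic_trialStates[_mu_zero_rows]` — the GC ε-minimiser floor
  `(c − u − ε)/(2h) ≤ Re ω(P₀^d)` with `hcap` DISCHARGED (`c ≤ p(1,t′,U,μ)` the `μ`-floor premise).
* §2 the `(t′, U) = (0, 8)` instance at `μ₄₇₃ = 980464777135/2³⁹` with the `μ`-floor premise `hμ` of
  `re_expect_localPairAt_ge_anchor473_gc` (the tangent reading of #473 — a HYPOTHESIS, not the landed one-density
  node) and ONE trial family with symbolic exact rows `(n, e₀)` on the `μ = 0` pencil (var-10's 32 × 4 box state /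
  one of pilot-1's cluster states): floor `((ℓ₄₇₃ − (7/8)μ₄₇₃) − (e₀ − μ₄₇₃·n) − ε)/(2h)` on every GC ε-minimiser, and
  GC ε-minimisers exist.

HONEST FRAMING: finite-field RESPONSE floors at ONE chemical potential on ε-minimisers of the sourced mean energy,
CONDITIONAL on the `μ`-floor premise and the trial rows; not an order parameter, not a phase word, not a
superconductivity verdict. Zero compute; no definition; no named fact.
-/

noncomputable section

namespace Summit.Ventures.CertifiedManyBodySolver.Observables

open Literature.MathematicalPhysics.QuantumLattice Literature.Probability.LatticeModels
open InfVolFermionState ThermodynamicLimit Matrix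

/-! ### §1 The grand-canonical `hcap` from ONE periodic trial family, and the GC ε-minimiser floor -/

section Generic

variable {ω : InfVolFermionState 2} {t' U μ h c ε n e e₀ u : ℝ} {q : ℕ}

/-- **GC cap from one periodic trial family (rows on the `μ`-pencil).** Unit torus trial vectors on the tori
`q ∣ L`, `L ≥ L₀` with exact rows `(n, e)` for `dWaveSourceTorusTT' L t′ U μ h`, `n ∈ (0,2)`, `e ≤ u`: SOME
translation-invariant state with density in `(0,2)` (namely `n`) has `E^{μ}_h ≤ u`.
[cite: BratteliRobinsonI1987, §4.3.1] -/
theorem exists_gcClass_sourced_le_of_periodic_trialStates (t' U μ h : ℝ) (hq : 0 < q) (L₀ : ℕ)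
    (hrows : ∀ L : ℕ, q ∣ L → L₀ ≤ L → ∀ [NeZero L], ∃ ψ : Fock (Orb (FermionTorus 2 L)),
      star ψ ⬝ᵥ ψ = 1 ∧ (expect totalNumber ψ).re = n * (L : ℝ) ^ 2 ∧
        (expect (dWaveSourceTorusTT' L t' U μ h) ψ).re = e * (L : ℝ) ^ 2)
    (hn0 : 0 < n) (hn2 : n < 2) (hu : e ≤ u) :
    ∃ σ : InfVolFermionState 2, σ.IsTranslationInvariant ∧ 0 < σ.density ∧ σ.density < 2 ∧
      σ.meanEnergy (hubbardTTPrimeSourcedInteraction 1 t' U μ dWaveFormFactor h) 1 ≤ u := by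
  obtain ⟨σ, hσ, hρ, hE⟩ :=
    exists_isTranslationInvariant_density_eq_meanEnergy_sourced_eq_of_periodic_trialStates t' U μ h hq L₀ hrows
  exact ⟨σ, hσ, hρ.symm ▸ hn0, hρ.symm ▸ hn2, hE.le.trans hu⟩

/-- **Rows on the `μ = 0` pencil serve EVERY `μ`.** Exact rows `(n, e₀)` for `dWaveSourceTorusTT' L t′ U 0 h` give,
for every `μ`, a translation-invariant `σ` of density `n` with `E^{μ}_h(σ) = e₀ − μ·n` (`E^{μ}_h = E^{0}_h − μρ`,
`meanEnergy_hubbardTTPrimeSourced_mu_eq`). [cite: KomaTasaki1994, §1] -/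
theorem exists_isTranslationInvariant_density_eq_meanEnergy_sourced_mu_of_periodic_trialStates (t' U h : ℝ)
    (hq : 0 < q) (L₀ : ℕ)
    (hrows : ∀ L : ℕ, q ∣ L → L₀ ≤ L → ∀ [NeZero L], ∃ ψ : Fock (Orb (FermionTorus 2 L)),
      star ψ ⬝ᵥ ψ = 1 ∧ (expect totalNumber ψ).re = n * (L : ℝ) ^ 2 ∧
        (expect (dWaveSourceTorusTT' L t' U 0 h) ψ).re = e₀ * (L : ℝ) ^ 2) (μ : ℝ) :
    ∃ σ : InfVolFermionState 2, σ.IsTranslationInvariant ∧ σ.density = n ∧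
      σ.meanEnergy (hubbardTTPrimeSourcedInteraction 1 t' U μ dWaveFormFactor h) 1 = e₀ - μ * n := by
  obtain ⟨σ, hσ, hρ, hE⟩ :=
    exists_isTranslationInvariant_density_eq_meanEnergy_sourced_eq_of_periodic_trialStates t' U 0 h hq L₀ hrows
  exact ⟨σ, hσ, hρ, by rw [meanEnergy_hubbardTTPrimeSourced_mu_eq σ hρ, hE]⟩

/-- **GC cap at `μ` from `μ = 0`-pencil rows**: `n ∈ (0,2)` and `e₀ − μn ≤ u` give the GC `hcap` at `μ`.
[cite: BratteliRobinsonI1987, §4.3.1] -/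
theorem exists_gcClass_sourced_le_of_periodic_trialStates_mu_zero_rows (t' U μ h : ℝ) (hq : 0 < q) (L₀ : ℕ)
    (hrows : ∀ L : ℕ, q ∣ L → L₀ ≤ L → ∀ [NeZero L], ∃ ψ : Fock (Orb (FermionTorus 2 L)),
      star ψ ⬝ᵥ ψ = 1 ∧ (expect totalNumber ψ).re = n * (L : ℝ) ^ 2 ∧
        (expect (dWaveSourceTorusTT' L t' U 0 h) ψ).re = e₀ * (L : ℝ) ^ 2)
    (hn0 : 0 < n) (hn2 : n < 2) (hu : e₀ - μ * n ≤ u) :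
    ∃ σ : InfVolFermionState 2, σ.IsTranslationInvariant ∧ 0 < σ.density ∧ σ.density < 2 ∧
      σ.meanEnergy (hubbardTTPrimeSourcedInteraction 1 t' U μ dWaveFormFactor h) 1 ≤ u := by
  obtain ⟨σ, hσ, hρ, hE⟩ :=
    exists_isTranslationInvariant_density_eq_meanEnergy_sourced_mu_of_periodic_trialStates t' U h hq L₀ hrows μ
  exact ⟨σ, hσ, hρ.symm ▸ hn0, hρ.symm ▸ hn2, hE.le.trans hu⟩

/-- **The GC ε-minimiser chord floor with `hcap` DISCHARGED from one trial family (rows on the `μ`-pencil).**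
For every translation-invariant `ω` with density in `(0,2)` that ε-minimises `E^{μ}_h` over that class, the
`μ`-floor `c ≤ p(1,t′,U,μ)` and a trial family with exact rows `(n, e)` at the pencil `μ` give
`(c − e − ε)/(2h) ≤ Re ω(P₀^d)`. [cite: Griffiths1966, §II] [cite: Ruelle1969, §3.4] -/
theorem re_expect_localPairAt_ge_of_gcEpsMinimiser_of_periodic_trialStates (hω : ω.IsTranslationInvariant)
    (hU : 0 ≤ U) (hρ0 : 0 < ω.density) (hρ2 : ω.density < 2) (hh : 0 < h)
    (hc : c ≤ gcEnergyDensityTT' 1 t' U μ)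
    (hmin : ∀ ω' : InfVolFermionState 2, ω'.IsTranslationInvariant → 0 < ω'.density → ω'.density < 2 →
      ω.meanEnergy (hubbardTTPrimeSourcedInteraction 1 t' U μ dWaveFormFactor h) 1 ≤
        ω'.meanEnergy (hubbardTTPrimeSourcedInteraction 1 t' U μ dWaveFormFactor h) 1 + ε)
    (hq : 0 < q) (L₀ : ℕ)
    (hrows : ∀ L : ℕ, q ∣ L → L₀ ≤ L → ∀ [NeZero L], ∃ ψ : Fock (Orb (FermionTorus 2 L)),
      star ψ ⬝ᵥ ψ = 1 ∧ (expect totalNumber ψ).re = n * (L : ℝ) ^ 2 ∧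
        (expect (dWaveSourceTorusTT' L t' U μ h) ψ).re = e * (L : ℝ) ^ 2)
    (hn0 : 0 < n) (hn2 : n < 2) :
    (c - e - ε) / (2 * h) ≤
      (ω.expect (pairRegion (insert 0 unitSteps) 0) (localPairAt (insert 0 unitSteps) dWaveFormFactor 0)).re :=
  re_expect_localPairAt_ge_of_gcEpsMinimiser hω hU hρ0 hρ2 hh hc hmin
    (exists_gcClass_sourced_le_of_periodic_trialStates t' U μ h hq L₀ hrows hn0 hn2 le_rfl)

/-- **The same from `μ = 0`-pencil rows `(n, e₀)`**: `(c − (e₀ − μn) − ε)/(2h) ≤ Re ω(P₀^d)` for every GC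
ε-minimiser at `μ`. [cite: Griffiths1966, §II] [cite: Ruelle1969, §3.4] -/
theorem re_expect_localPairAt_ge_of_gcEpsMinimiser_of_periodic_trialStates_mu_zero_rows
    (hω : ω.IsTranslationInvariant) (hU : 0 ≤ U) (hρ0 : 0 < ω.density) (hρ2 : ω.density < 2) (hh : 0 < h)
    (hc : c ≤ gcEnergyDensityTT' 1 t' U μ)
    (hmin : ∀ ω' : InfVolFermionState 2, ω'.IsTranslationInvariant → 0 < ω'.density → ω'.density < 2 →
      ω.meanEnergy (hubbardTTPrimeSourcedInteraction 1 t' U μ dWaveFormFactor h) 1 ≤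
        ω'.meanEnergy (hubbardTTPrimeSourcedInteraction 1 t' U μ dWaveFormFactor h) 1 + ε)
    (hq : 0 < q) (L₀ : ℕ)
    (hrows : ∀ L : ℕ, q ∣ L → L₀ ≤ L → ∀ [NeZero L], ∃ ψ : Fock (Orb (FermionTorus 2 L)),
      star ψ ⬝ᵥ ψ = 1 ∧ (expect totalNumber ψ).re = n * (L : ℝ) ^ 2 ∧
        (expect (dWaveSourceTorusTT' L t' U 0 h) ψ).re = e₀ * (L : ℝ) ^ 2)
    (hn0 : 0 < n) (hn2 : n < 2) :
    (c - (e₀ - μ * n) - ε) / (2 * h) ≤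
      (ω.expect (pairRegion (insert 0 unitSteps) 0) (localPairAt (insert 0 unitSteps) dWaveFormFactor 0)).re :=
  re_expect_localPairAt_ge_of_gcEpsMinimiser hω hU hρ0 hρ2 hh hc hmin
    (exists_gcClass_sourced_le_of_periodic_trialStates_mu_zero_rows t' U μ h hq L₀ hrows hn0 hn2 le_rfl)

/-- **GC ε-minimisers exist once a trial family does** (the class `{TI, 0 < ρ < 2}` is then nonempty; hypothesis-free
via `exists_epsMinimiser_gcClass`). [cite: BratteliRobinsonI1987, Prop. 2.3.11] -/
theorem exists_gcEpsMinimiser_of_periodic_trialStates (Ψ : FermionInteraction 2) (t' U μ h : ℝ) (hq : 0 < q)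
    (L₀ : ℕ)
    (hrows : ∀ L : ℕ, q ∣ L → L₀ ≤ L → ∀ [NeZero L], ∃ ψ : Fock (Orb (FermionTorus 2 L)),
      star ψ ⬝ᵥ ψ = 1 ∧ (expect totalNumber ψ).re = n * (L : ℝ) ^ 2 ∧
        (expect (dWaveSourceTorusTT' L t' U μ h) ψ).re = e * (L : ℝ) ^ 2)
    (hn0 : 0 < n) (hn2 : n < 2) (hε : 0 < ε) :
    ∃ ω : InfVolFermionState 2, ω.IsTranslationInvariant ∧ 0 < ω.density ∧ ω.density < 2 ∧
      ∀ ω' : InfVolFermionState 2, ω'.IsTranslationInvariant → 0 < ω'.density → ω'.density < 2 →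
        ω.meanEnergy Ψ 1 ≤ ω'.meanEnergy Ψ 1 + ε := by
  obtain ⟨σ, hσ, hσ0, hσ2, -⟩ := exists_gcClass_sourced_le_of_periodic_trialStates t' U μ h hq L₀ hrows hn0 hn2 le_rfl
  exact exists_epsMinimiser_gcClass Ψ ⟨σ, hσ, hσ0, hσ2⟩ hε

/-- **`t′ = 0` form of the GC cap from `μ = 0`-pencil rows** (rows for the tree's `dWaveSourceTorus L U 0 h`).
[cite: BratteliRobinsonI1987, §4.3.1] -/
theorem exists_gcClass_sourced_le_of_periodic_trialStates_mu_zero_rows_tp_zero (U μ h : ℝ) (hq : 0 < q)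
    (L₀ : ℕ)
    (hrows : ∀ L : ℕ, q ∣ L → L₀ ≤ L → ∀ [NeZero L], ∃ ψ : Fock (Orb (FermionTorus 2 L)),
      star ψ ⬝ᵥ ψ = 1 ∧ (expect totalNumber ψ).re = n * (L : ℝ) ^ 2 ∧
        (expect (dWaveSourceTorus L U 0 h) ψ).re = e₀ * (L : ℝ) ^ 2)
    (hn0 : 0 < n) (hn2 : n < 2) (hu : e₀ - μ * n ≤ u) :
    ∃ σ : InfVolFermionState 2, σ.IsTranslationInvariant ∧ 0 < σ.density ∧ σ.density < 2 ∧
      σ.meanEnergy (hubbardTTPrimeSourcedInteraction 1 0 U μ dWaveFormFactor h) 1 ≤ u := by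
  refine exists_gcClass_sourced_le_of_periodic_trialStates_mu_zero_rows 0 U μ h hq L₀ (fun L hqL hL _ => ?_)
    hn0 hn2 hu
  simpa only [dWaveSourceTorusTT'_zero_tp] using hrows L hqL hL

end Generic

/-! ### §2 The `(t′, U) = (0, 8)` instance at `μ₄₇₃ = 980464777135/2³⁹` with one trial family -/

section Anchor473

variable {ω : InfVolFermionState 2} {h n e₀ ε : ℝ} {q : ℕ}

/-- **B1 in the grand-canonical class at `μ₄₇₃` with `hcap` DISCHARGED from ONE trial family.** Premises: the
`μ`-floor `hμ : ℓ₄₇₃ − (7/8)μ₄₇₃ ≤ gcEnergyDensityTT' 1 0 8 μ₄₇₃` (the all-density tangent reading of #473's dual —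
a HYPOTHESIS, see `re_expect_localPairAt_ge_anchor473_gc`) and, on the tori `q ∣ L`, `L ≥ L₀`, unit trial vectors
with exact rows `Re⟨ψ, Nψ⟩ = n·L²`, `Re⟨ψ, (H − h(Δ_d+Δ_d†))ψ⟩ = e₀·L²` (`μ = 0` pencil; `n ∈ (0,2)`; the tiled
product of ONE parity-definite box / cluster vector). Conclusion: every translation-invariant GC ε-minimiser `ω`
of `E^{μ₄₇₃}_h` has `Re ω(P₀^d) ≥ ((ℓ₄₇₃ − (7/8)μ₄₇₃) − (e₀ − μ₄₇₃·n) − ε)/(2h)`. A finite-field RESPONSE floor at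
one chemical potential, CONDITIONAL on `hμ` and the rows; not an order parameter. [cite: Griffiths1966, §II] -/
theorem re_expect_localPairAt_ge_of_gcEpsMinimiser_anchor473_of_trialRows (hω : ω.IsTranslationInvariant)
    (hρ0 : 0 < ω.density) (hρ2 : ω.density < 2) (hh : 0 < h)
    (hμ : (((-1012151804787154021296135 / 1208925819614629174706176 : ℚ) -
        7 / 8 * (980464777135 / 549755813888 : ℚ) : ℚ) : ℝ) ≤
      gcEnergyDensityTT' 1 0 8 ((980464777135 / 549755813888 : ℚ) : ℝ))
    (hmin : ∀ ω' : InfVolFermionState 2, ω'.IsTranslationInvariant → 0 < ω'.density → ω'.density < 2 →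
      ω.meanEnergy (hubbardTTPrimeSourcedInteraction 1 0 8 ((980464777135 / 549755813888 : ℚ) : ℝ)
          dWaveFormFactor h) 1 ≤
        ω'.meanEnergy (hubbardTTPrimeSourcedInteraction 1 0 8 ((980464777135 / 549755813888 : ℚ) : ℝ)
          dWaveFormFactor h) 1 + ε)
    (hq : 0 < q) (L₀ : ℕ)
    (hrows : ∀ L : ℕ, q ∣ L → L₀ ≤ L → ∀ [NeZero L], ∃ ψ : Fock (Orb (FermionTorus 2 L)),
      star ψ ⬝ᵥ ψ = 1 ∧ (expect totalNumber ψ).re = n * (L : ℝ) ^ 2 ∧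
        (expect (dWaveSourceTorus L 8 0 h) ψ).re = e₀ * (L : ℝ) ^ 2)
    (hn0 : 0 < n) (hn2 : n < 2) :
    ((((-1012151804787154021296135 / 1208925819614629174706176 : ℚ) -
        7 / 8 * (980464777135 / 549755813888 : ℚ) : ℚ) : ℝ) -
        (e₀ - ((980464777135 / 549755813888 : ℚ) : ℝ) * n) - ε) / (2 * h) ≤
      (ω.expect (pairRegion (insert 0 unitSteps) 0) (localPairAt (insert 0 unitSteps) dWaveFormFactor 0)).re := by
  refine re_expect_localPairAt_ge_of_gcEpsMinimiser_of_periodic_trialStates_mu_zero_rows hω (by norm_num) hρ0 hρ2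
    hh hμ hmin hq L₀ (fun L hqL hL _ => ?_) hn0 hn2
  simpa only [dWaveSourceTorusTT'_zero_tp] using hrows L hqL hL

/-- **GC ε-minimisers at `μ₄₇₃` exist** once the trial family does, for every `ε > 0`.
[cite: BratteliRobinsonI1987, Prop. 2.3.11] -/
theorem exists_gcEpsMinimiser_anchor473_of_trialRows (hq : 0 < q) (L₀ : ℕ)
    (hrows : ∀ L : ℕ, q ∣ L → L₀ ≤ L → ∀ [NeZero L], ∃ ψ : Fock (Orb (FermionTorus 2 L)),
      star ψ ⬝ᵥ ψ = 1 ∧ (expect totalNumber ψ).re = n * (L : ℝ) ^ 2 ∧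
        (expect (dWaveSourceTorus L 8 0 h) ψ).re = e₀ * (L : ℝ) ^ 2)
    (hn0 : 0 < n) (hn2 : n < 2) (hε : 0 < ε) :
    ∃ ω : InfVolFermionState 2, ω.IsTranslationInvariant ∧ 0 < ω.density ∧ ω.density < 2 ∧
      ∀ ω' : InfVolFermionState 2, ω'.IsTranslationInvariant → 0 < ω'.density → ω'.density < 2 →
        ω.meanEnergy (hubbardTTPrimeSourcedInteraction 1 0 8 ((980464777135 / 549755813888 : ℚ) : ℝ)
            dWaveFormFactor h) 1 ≤
          ω'.meanEnergy (hubbardTTPrimeSourcedInteraction 1 0 8 ((980464777135 / 549755813888 : ℚ) : ℝ)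
            dWaveFormFactor h) 1 + ε := by
  refine exists_gcEpsMinimiser_of_periodic_trialStates (n := n) (e := e₀) _ 0 8 0 h hq L₀ (fun L hqL hL _ => ?_)
    hn0 hn2 hε
  simpa only [dWaveSourceTorusTT'_zero_tp] using hrows L hqL hL

end Anchor473

end Summit.Ventures.CertifiedManyBodySolver.Observables

end
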